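import Mathlib
import Summits.PneNP.PneNP.Theses.OverlapGapAlgebra
import Summits.PneNP.PneNP.Theorems.OverlapGapAlgebraSearchHardWindowSmoothMapsFail
import Summits.PneNP.PneNP.Theorems.OverlapGapAlgebraSearchHardWindowLowDegreeStability
import Literature.Computability.Complexity.RandomKSatLowDegreeHardness

/-!
# Route OverlapGapAlgebra, crux `SearchHardWindow` (stmt-PneNP-2460): weak low-degree hardness
# from `NoStableSection`

**Bresler–Huang 2021, Theorem 2.6 (hardness of random `k`-SAT for low-degree polynomials) in the
deterministic, saturated-output form of the tree's named fact `HuangSellke2025KSat`, with success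
probability `1 − Ω_k(1/log n)` instead of `o(1)`, PROVED modulo the route's probability crux
`NoStableSection` (stmt-PneNP-2462).** For `k ≥ k₀` there is `c > 0` such that for every energy
constant `C`, every coordinate-degree sequence `D_n = o(n / log n)` and every sequence of
vector-valued functions `F_n` on literal arrays of coordinate (Efron–Stein) degree `≤ D_n` and energy
`Σ_Φ ‖F_n Φ‖² ≤ C n · #Φ`: eventually, the literal arrays `Φ` of `F_k(n, ⌊5·2^k log k/k · n⌋)` on
which every output `|F_n(Φ)_v| ≥ 1` AND the sign assignment satisfies `Φ` number at most
`(1 − c/log(2n)) · #Φ`.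

Compared with the printed Theorem 2.6 (arXiv:2106.02129: degree `D ≤ C₁ n/(γ log n)`, failure
probability `δ ≤ exp(−C₂ γ D log n)` excluded) the admissible failure probability here is
`c/log(2n)`, uniformly in `D` and `C` — the gain comes from the route's ENGINE (the bad-vertex set
is folded into the bad-edge relation of the resampling walk instead of a union bound over the
`k²m + 1` points of the path). Compared with Huang–Sellke 2025 Cor. 3.21 (`HuangSellke2025KSat`:
success `o(1)`, degree `o(n)`) it is the weak, OGP-type statement; but it rests on no named fact.

Mechanism: (1) `Literature.Probability.Moments.sum_sum_sum_sq_sub_update_le` (Hoeffding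
decomposition: total `L²`-influence `≤ degree × energy`) turns coordinate degree `≤ D` and energy
`≤ C n #Φ` into the average-stability budget of (2) the smooth-maps rung
`smoothMapsFail_of_noStableSection` (Bresler–Huang Thm. 2.6 in the authors' general form, from the
accepted engine of crux `SolvableImpliesStableSection` and `NoStableSection`), via (3) the elementary
fact that two saturated sign vectors differ in at most `‖F(Φ) − F(Φ')‖²` coordinates.

References: G. Bresler, B. Huang, FOCS 2021 / arXiv:2106.02129, Thm. 2.6, §6 [BreslerHuang2022];
B. Huang, M. Sellke, arXiv:2501.06427, Cor. 3.21 [HuangSellke2025]; R. O'Donnell, *Analysis of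
Boolean Functions*, CUP 2014, §8.3–8.4 [ODonnell2014].
-/

namespace Summit.PneNP.PneNP.Theorems

set_option linter.dupNamespace false -- `Summit.PneNP.PneNP.…`: summit = sub-problem (D-0017)

open Finset Filter Asymptotics
open Summit.PneNP.PneNP.Theses.OverlapGapAlgebra
open Literature.Computability.Complexity (IsCoordDegreeLE)
open Literature.Probability.Moments
open scoped Classical

/-- **Weak low-degree hardness of random `k`-SAT at the window density, modulo `NoStableSection`
(Bresler–Huang 2021 Thm. 2.6, deterministic saturated form; cf. the named fact
`HuangSellke2025KSat`).** Assume `NoStableSection` (stmt-PneNP-2462). There is `k₀` such that for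
every `k ≥ k₀` there is `c > 0` with: for every `C > 0`, every degree sequence `D_n = o(n/log n)` and
every `F_n : (Fin m → Fin k → Fin n × Bool) → (Fin n → ℝ)`, `m = ⌊5·2^k log k/k · n⌋`, of coordinate
degree `≤ D_n` in the `m·k` literal coordinates and energy `Σ_Φ Σ_v F_n(Φ)_v² ≤ C·n·#Φ`, eventually
in `n` the literal arrays `Φ` with every `|F_n(Φ)_v| ≥ 1` and `v ↦ (0 ≤ F_n(Φ)_v)` satisfying `Φ`
number at most `(1 − c/log(2n)) · #Φ`. [BreslerHuang2022, Thm. 2.6; HuangSellke2025, Cor. 3.21;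
ODonnell2014, §8.3] -/
theorem weakLowDegreeHardness_of_noStableSection (hNo : NoStableSection) :
    ∃ k₀ : ℕ, ∀ k : ℕ, k₀ ≤ k → ∃ c : ℝ, 0 < c ∧ ∀ C : ℝ, 0 < C → ∀ D : ℕ → ℕ,
      (fun n : ℕ => (D n : ℝ)) =o[atTop] (fun n : ℕ => (n : ℝ) / Real.log n) →
      ∀ F : (n : ℕ) → (m : ℕ) → (Fin m → Fin k → Fin n × Bool) → Fin n → ℝ,
        (∀ (n m : ℕ) (v : Fin n), IsCoordDegreeLE (D n)
            (fun y : Fin m × Fin k → Fin n × Bool => F n m (Function.curry y) v)) →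
        (∀ n m : ℕ, m = ⌊5 * 2 ^ k * Real.log k / k * n⌋₊ →
            ∑ Φ : Fin m → Fin k → Fin n × Bool, ∑ v : Fin n, F n m Φ v ^ 2
              ≤ C * n * Fintype.card (Fin m → Fin k → Fin n × Bool)) →
        ∀ᶠ n : ℕ in atTop, ∀ m : ℕ, m = ⌊5 * 2 ^ k * Real.log k / k * n⌋₊ →
          ((univ.filter fun Φ : Fin m → Fin k → Fin n × Bool =>
              (∀ v : Fin n, 1 ≤ |F n m Φ v|) ∧
              ∀ i : Fin m, ∃ j : Fin k, decide (0 ≤ F n m Φ (Φ i j).1) = (Φ i j).2).card : ℝ)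
            ≤ (1 - c / Real.log (2 * n)) * Fintype.card (Fin m → Fin k → Fin n × Bool) := by
  obtain ⟨k₁, hk₁⟩ := smoothMapsFail_of_noStableSection hNo
  refine ⟨max k₁ 3, fun k hk => ?_⟩
  have hk1 : k₁ ≤ k := le_trans (le_max_left _ _) hk
  have hk3 : 3 ≤ k := le_trans (le_max_right _ _) hk
  obtain ⟨η, hη, ν, hν, c₀, hc₀, hev⟩ := hk₁ k hk1
  have hα1 : (1 : ℝ) ≤ 5 * 2 ^ k * Real.log k / k := smoothMaps_one_le_density hk3
  set α : ℝ := 5 * 2 ^ k * Real.log k / k with hα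
  have hαpos : 0 < α := by linarith
  have hkpos : (0 : ℝ) < k := by exact_mod_cast (by omega : 0 < k)
  refine ⟨c₀ / (2 * k * α), by positivity, ?_⟩
  intro C hC D hD F hdeg hener
  -- the degree eventuality: `D n ≤ (η c₀ /(16 C)) · n / log n`
  have hDev : ∀ᶠ n : ℕ in atTop, (D n : ℝ) ≤ η * c₀ / (16 * C) * (n / Real.log n) := by
    filter_upwards [hD.def (show (0 : ℝ) < η * c₀ / (16 * C) by positivity),
      eventually_ge_atTop 2] with n hn hn2
    have hn2' : (2 : ℝ) ≤ n := by exact_mod_cast hn2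
    have hlogpos : 0 < Real.log n := Real.log_pos (by linarith)
    rw [Real.norm_natCast, Real.norm_of_nonneg (by positivity)] at hn
    exact hn
  filter_upwards [hev, hDev, eventually_ge_atTop 2] with n hS hDn hn2 m hm
  -- positivity bookkeeping
  have hn1 : 1 ≤ n := by omega
  have hn1' : (1 : ℝ) ≤ n := by exact_mod_cast hn1
  have hn2' : (2 : ℝ) ≤ n := by exact_mod_cast hn2
  have hlog2 : 0 < Real.log 2 := Real.log_pos (by norm_num)
  have hlogn : Real.log 2 ≤ Real.log n := Real.log_le_log (by norm_num) hn2'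
  have hlog2n : Real.log (2 * n) = Real.log 2 + Real.log n :=
    Real.log_mul (by norm_num) (by positivity)
  have hlog2n_pos : 0 < Real.log (2 * n) := by rw [hlog2n]; linarith
  have hlog2n_le : Real.log (2 * n) ≤ 2 * Real.log n := by rw [hlog2n]; linarith
  have hlognpos : 0 < Real.log n := by linarith
  have hmn : n ≤ m := by rw [hm]; exact smoothMaps_le_numClauses hk3 n
  have hm0 : (0 : ℝ) < m := by exact_mod_cast (lt_of_lt_of_le (by omega : 0 < n) hmn)
  have hmle : (m : ℝ) ≤ α * n := by rw [hm]; exact Nat.floor_le (by positivity)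
  have hmk : (0 : ℝ) < (m * k : ℕ) := by push_cast; exact mul_pos hm0 hkpos
  have hkm : (0 : ℝ) < (k * m : ℕ) := by push_cast; exact mul_pos hkpos hm0
  set B : ℝ := c₀ * n / Real.log (2 * n) with hB
  have hBpos : 0 < B := by positivity
  set N : ℝ := (Fintype.card (Fin m → Fin k → Fin n × Bool) : ℝ) with hN
  have hN0 : 0 ≤ N := Nat.cast_nonneg _
  set Fm : (Fin m → Fin k → Fin n × Bool) → Fin n → ℝ := F n m with hFm
  -- the three sets of instances
  set satSolve := univ.filter fun Φ : Fin m → Fin k → Fin n × Bool =>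
      (∀ v : Fin n, 1 ≤ |Fm Φ v|) ∧ ∀ i : Fin m, ∃ j : Fin k, decide (0 ≤ Fm Φ (Φ i j).1) = (Φ i j).2
    with hsatSolve
  set unsat := univ.filter fun Φ : Fin m → Fin k → Fin n × Bool => ¬ ∀ v, 1 ≤ |Fm Φ v|
    with hunsat
  set invalid := univ.filter fun Φ : Fin m → Fin k → Fin n × Bool =>
      ν * m < ((univ.filter fun i : Fin m => ∀ j, decide (0 ≤ Fm Φ (Φ i j).1) ≠ (Φ i j).2).card : ℝ)
    with hinvalid
  -- the rate: `c/log(2n) ≤ B/(2mk)`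
  have hrate : c₀ / (2 * k * α) / Real.log (2 * n) ≤ B / (2 * (m * k : ℕ)) := by
    rw [hB, div_div, div_div, div_le_div_iff₀ (by positivity) (by positivity)]
    push_cast
    have key : (m : ℝ) * (c₀ * Real.log (2 * n) * (2 * k)) ≤
        α * n * (c₀ * Real.log (2 * n) * (2 * k)) :=
      mul_le_mul_of_nonneg_right hmle (by positivity)
    nlinarith [key]
  suffices hmain : (satSolve.card : ℝ) ≤ N - B / (2 * (m * k : ℕ)) * N by
    calc (satSolve.card : ℝ) ≤ N - B / (2 * (m * k : ℕ)) * N := hmain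
      _ ≤ N - c₀ / (2 * k * α) / Real.log (2 * n) * N := by
          nlinarith [mul_le_mul_of_nonneg_right hrate hN0]
      _ = (1 - c₀ / (2 * k * α) / Real.log (2 * n)) * N := by ring
  -- `sat ∧ solve ⊆ sat`: `#satSolve ≤ N − #unsat`
  have hss_sat : (satSolve.card : ℝ) ≤ N - unsat.card := by
    have h1 : satSolve.card ≤
        (univ.filter fun Φ : Fin m → Fin k → Fin n × Bool => ∀ v, 1 ≤ |Fm Φ v|).card :=
      card_le_card fun Φ hΦ => by
        simp only [hsatSolve, mem_filter, mem_univ, true_and] at hΦ ⊢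
        exact hΦ.1
    have h2 : ((univ.filter fun Φ : Fin m → Fin k → Fin n × Bool => ∀ v, 1 ≤ |Fm Φ v|).card : ℝ) +
        unsat.card = N := by
      rw [hN, ← card_univ, hunsat]
      exact_mod_cast card_filter_add_card_filter_not (s := univ) _
    have h1' : (satSolve.card : ℝ) ≤
        ((univ.filter fun Φ : Fin m → Fin k → Fin n × Bool => ∀ v, 1 ≤ |Fm Φ v|).card : ℝ) :=
      Nat.cast_le.2 h1
    linarith
  -- `sat ∧ solve ⊆ valid`: `#satSolve ≤ N − #invalid`
  have hss_val : (satSolve.card : ℝ) ≤ N - invalid.card := by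
    have h1 : satSolve.card ≤ (univ.filter fun Φ : Fin m → Fin k → Fin n × Bool =>
        ¬ ν * m < ((univ.filter fun i : Fin m =>
          ∀ j, decide (0 ≤ Fm Φ (Φ i j).1) ≠ (Φ i j).2).card : ℝ)).card := by
      refine card_le_card fun Φ hΦ => ?_
      simp only [hsatSolve, mem_filter, mem_univ, true_and] at hΦ ⊢
      rw [not_lt]
      have hempty : (univ.filter fun i : Fin m => ∀ j, decide (0 ≤ Fm Φ (Φ i j).1) ≠ (Φ i j).2) = ∅ :=
        filter_eq_empty_iff.2 fun i _ hi => by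
          obtain ⟨j, hj⟩ := hΦ.2 i
          exact hi j hj
      rw [hempty, card_empty, Nat.cast_zero]
      positivity
    have h2 : (invalid.card : ℝ) + ((univ.filter fun Φ : Fin m → Fin k → Fin n × Bool =>
        ¬ ν * m < ((univ.filter fun i : Fin m =>
          ∀ j, decide (0 ≤ Fm Φ (Φ i j).1) ≠ (Φ i j).2).card : ℝ)).card : ℝ) = N := by
      rw [hN, ← card_univ, hinvalid]
      exact_mod_cast card_filter_add_card_filter_not (s := univ) _
    have h1' := (Nat.cast_le (α := ℝ)).2 h1
    linarith
  by_cases hcase : B / 2 * N < (m * k : ℕ) * (unsat.card : ℝ)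
  · -- case A: many unsaturated instances
    have hU : B / (2 * (m * k : ℕ)) * N < unsat.card := by
      rw [div_mul_eq_mul_div, div_lt_iff₀ (by positivity)]
      linarith
    linarith
  · -- case B: the stability budget holds — apply the smooth-maps rung to the sign map of `F`
    rw [not_lt] at hcase
    have hjump := wld_jumpCount_le hn1 hη Fm (hdeg n m)
    have hE : ∑ Φ : Fin m → Fin k → Fin n × Bool, ∑ v, Fm Φ v ^ 2 ≤ C * n * N := hener n m hm
    have hDn' : (D n : ℝ) ≤ η * c₀ / (8 * C) * (n / Real.log (2 * n)) := by
      have hcmp : (n : ℝ) / Real.log n ≤ 2 * (n / Real.log (2 * n)) := by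
        rw [mul_div_assoc', div_le_div_iff₀ hlognpos hlog2n_pos]
        nlinarith [hlog2n_le, hn1']
      calc (D n : ℝ) ≤ η * c₀ / (16 * C) * (n / Real.log n) := hDn
        _ ≤ η * c₀ / (16 * C) * (2 * (n / Real.log (2 * n))) :=
            mul_le_mul_of_nonneg_left hcmp (by positivity)
        _ = η * c₀ / (8 * C) * (n / Real.log (2 * n)) := by ring
    have hbudget : 2 * n * ((m * k : ℕ) * (unsat.card : ℝ)) +
        4 * (D n) / η * ∑ Φ : Fin m → Fin k → Fin n × Bool, ∑ v, Fm Φ v ^ 2 ≤ B * (N * (2 * n)) := by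
      have h1 : 2 * n * ((m * k : ℕ) * (unsat.card : ℝ)) ≤ 2 * n * (B / 2 * N) :=
        mul_le_mul_of_nonneg_left hcase (by positivity)
      have h2 : 4 * (D n : ℝ) / η * ∑ Φ : Fin m → Fin k → Fin n × Bool, ∑ v, Fm Φ v ^ 2 ≤
          4 * (D n) / η * (C * n * N) := mul_le_mul_of_nonneg_left hE (by positivity)
      have h3 : 4 * (D n : ℝ) / η * (C * n * N) ≤
          4 * (η * c₀ / (8 * C) * (n / Real.log (2 * n))) / η * (C * n * N) := by
        gcongr
      have h4 : 4 * (η * c₀ / (8 * C) * (n / Real.log (2 * n))) / η * (C * n * N) =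
          B / 2 * (n * N) := by
        rw [hB]
        field_simp
        ring
      have hnBN : 0 ≤ (n : ℝ) * B * N := by positivity
      linarith [h1, h2, h3, h4, hnBN]
    have hS1 := hS m hm (fun Φ v => decide (0 ≤ Fm Φ v))
    have hJB := hjump.trans hbudget
    have hfire := hS1 hJB
    -- `hfire : B * N < (k m) * #invalid`
    have hinv : B / (k * m : ℕ) * N < invalid.card := by
      rw [div_mul_eq_mul_div, div_lt_iff₀ hkm]
      linarith
    have hhalf : B / (2 * (m * k : ℕ)) * N ≤ B / (k * m : ℕ) * N := by
      refine mul_le_mul_of_nonneg_right ?_ hN0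
      refine div_le_div_of_nonneg_left hBpos.le hkm ?_
      push_cast; linarith [mul_pos hm0 hkpos]
    linarith

end Summit.PneNP.PneNP.Theorems
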